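import Summits.QuantumFields.YangMills.Theorems.FemtoTransferGapPhysL2
import Summits.QuantumFields.YangMills.Theorems.FemtoTransferGapAdjoint
import Literature.MathematicalPhysics.QuantumLattice.HeatKernelGroupGaugeProofs
import Mathlib.Algebra.Polynomial.Roots
import Mathlib.LinearAlgebra.CrossProduct

/-!
# The physical closed subspace of `L²(configMeasure)` is infinite-dimensional (fixed lattice `(ℤ/L)³`, `SU(2)`, every `L ≥ 1`)

Fleet-service module of seat ym-infvol-p2 g4 (route `LuscherReduction`, crux RED `stmt-QuantumFields-19978`, line «KTR»): step 2 of the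
SPECTRAL ATTAINMENT bridge (`Theorems/FemtoTransferGapPhysL2.lean` p494018 = step 1; target: discharge the attainment hypothesis of
`KTRCalibration.dressedRitz_of_runningReduction`, p492709).  The Hilbert–Schmidt ∕ min–max package of the tree
(`Literature/Analysis/OperatorTheory/CompactPositiveMinMaxLevels.lean`) asks for a Hilbert space that is NOT finite-dimensional; this file
proves it for the physical closed subspace `physL2 L`:

* §5 a physical observable with infinitely many values: `plaqObs L U = scalarPart U_{(0;0,1)}` (half the real trace of the plaquette
  holonomy at the origin); its powers are physical zero-flux test functions (`isPhys_plaqObs_pow`: gauge covariance of the holonomy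
  `plaquetteHolonomy_gaugeTransform` + `scalarPart_conj`, twist invariance `plaquetteHolonomy_twist_of_mem_center`); on the TWO-LINK
  configurations (all direction-0 links `= a`, all direction-1 links `= b`: every `(0,1)` holonomy is the commutator `aba⁻¹b⁻¹`, for EVERY
  `L`, no lattice arithmetic) with `a = chartSU2 (θe₀)`, `b = chartSU2 e₁` it takes the value `1 − 2θ²` (tree `two_sub_re_trace_comm_eq_cross`),
  so its range is infinite;
* §6 the a-priori measure has full support (product of Haar measures), so a continuous physical function with zero `L²` class vanishes
  identically; hence the classes of `plaqObs^n` are linearly independent (a vanishing combination is a polynomial with infinitely many roots)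
  and **`not_finiteDimensional_physL2 : ¬ FiniteDimensional ℝ (physL2 L)`**.

HONEST FRAMING: fixed-lattice elementary analysis; femto rung R2b1 infrastructure; nothing here bears on infinite volume, the continuum
limit or the Clay gap.
-/

set_option autoImplicit false

noncomputable section

open MeasureTheory Filter Topology Real
open Literature.MathematicalPhysics.QuantumFieldTheory
open Literature.MathematicalPhysics.QuantumLattice
open Literature.Analysis.OperatorTheory.YMMatrixModel
open Literature.Analysis.OperatorTheory
open scoped InnerProductSpace BigOperators

namespace Summit.QuantumFields.YangMills.Theorems.FemtoTransferGap.PhysL2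

open Summit.QuantumFields.YangMills.Theorems.FemtoTransferGap
open scoped Matrix

variable {L : ℕ} [NeZero L]

/-! ## §5 A physical observable with infinitely many values: the scalar part of a plaquette holonomy -/

variable (L) in
/-- The scalar (quaternion real) part of the holonomy of the plaquette at the origin in the `(0,1)` plane:
`U ↦ ½ Re tr U_{(0;0,1)}`. [cite: Luscher1983] -/
def plaqObs (U : GaugeConfig 3 L SU2) : ℝ := scalarPart (plaquetteHolonomy U (0 : Site 3 L) (0 : Fin 3) (1 : Fin 3))

omit [NeZero L] in
/-- The plaquette holonomy depends continuously on the configuration. [folklore] -/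
theorem continuous_plaquetteHolonomy (x : Site 3 L) (i j : Fin 3) :
    Continuous fun U : GaugeConfig 3 L SU2 => plaquetteHolonomy U x i j := by
  have h1 : Continuous fun U : GaugeConfig 3 L SU2 => U (x, i) := continuous_apply (x, i)
  have h2 : Continuous fun U : GaugeConfig 3 L SU2 => U (x.shift i, j) := continuous_apply (x.shift i, j)
  have h3 : Continuous fun U : GaugeConfig 3 L SU2 => U (x.shift j, i) := continuous_apply (x.shift j, i)
  have h4 : Continuous fun U : GaugeConfig 3 L SU2 => U (x, j) := continuous_apply (x, j)
  unfold plaquetteHolonomy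
  exact ((h1.mul h2).mul h3.inv).mul h4.inv

omit [NeZero L] in
/-- `plaqObs` is continuous. [folklore] -/
theorem continuous_plaqObs : Continuous (plaqObs L) :=
  continuous_scalarPart.comp (continuous_plaquetteHolonomy 0 0 1)

/-- **Powers of `plaqObs` are physical zero-flux test functions** (continuous, `|·| ≤ 1`, conjugation invariant under gauge
transformations — `plaquetteHolonomy_gaugeTransform` + `scalarPart_conj` —, twist invariant — `plaquetteHolonomy_twist_of_mem_center`).
[cite: Luscher1983] -/
theorem isPhys_plaqObs_pow (n : ℕ) : IsPhys (fun U : GaugeConfig 3 L SU2 => plaqObs L U ^ n) where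
  measurable := (continuous_plaqObs.pow n).measurable
  bounded := ⟨1, fun U => by
    rw [abs_pow]
    exact pow_le_one₀ (abs_nonneg _) (abs_scalarPart_le _)⟩
  gaugeInv := fun g U => by
    simp only [plaqObs]
    rw [Literature.MathematicalPhysics.QuantumLattice.plaquetteHolonomy_gaugeTransform, scalarPart_conj]
  zeroFlux := fun k z hz U => by
    simp only [plaqObs]
    rw [plaquetteHolonomy_twist_of_mem_center k hz U 0 (show (0 : Fin 3) ≠ 1 by decide)]

/-- The power `plaqObs^n` as an element of the physical subspace. [folklore] -/
def plaqObsPow (n : ℕ) : physSubmodule L := ⟨fun U => plaqObs L U ^ n, isPhys_plaqObs_pow n⟩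

/-- The two-link configurations: every link in direction `0` carries `a`, every link in direction `1` carries `b`, all others `1`.
[folklore] -/
def twoLinkCfg (a b : SU2) : GaugeConfig 3 L SU2 := fun e => if e.2 = 0 then a else if e.2 = 1 then b else 1

omit [NeZero L] in
/-- On a two-link configuration every `(0,1)` plaquette holonomy is the commutator `a b a⁻¹ b⁻¹` (any `L`, any base point —
no lattice arithmetic). [folklore] -/
theorem plaquetteHolonomy_twoLinkCfg (a b : SU2) (x : Site 3 L) :
    plaquetteHolonomy (twoLinkCfg (L := L) a b) x 0 1 = a * b * a⁻¹ * b⁻¹ := by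
  simp [plaquetteHolonomy, twoLinkCfg]

/-- `scalarPart (a b a⁻¹ b⁻¹) = 1 − 2 |u_a × u_b|²` (from the tree's `two_sub_re_trace_comm_eq_cross`). [cite: Luscher1983, §2] -/
theorem scalarPart_comm_eq (a b : SU2) :
    scalarPart (a * b * a⁻¹ * b⁻¹) = 1 - 2 * ((vecPart a ⨯₃ vecPart b) ⬝ᵥ (vecPart a ⨯₃ vecPart b)) := by
  have h := two_sub_re_trace_comm_eq_cross a b
  rw [re_trace_eq_two_mul_scalarPart] at h
  linarith

omit [NeZero L] in
/-- The explicit values: with `a = chartSU2 (θ e₀)`, `b = chartSU2 e₁` (`0 ≤ θ ≤ 1`): `plaqObs = 1 − 2θ²`. [folklore] -/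
theorem plaqObs_twoLinkCfg_chart {θ : ℝ} (hθ : θ ∈ Set.Icc (0 : ℝ) 1) :
    plaqObs L (twoLinkCfg (chartSU2 (Pi.single 0 θ)) (chartSU2 (Pi.single 1 1))) = 1 - 2 * θ ^ 2 := by
  have ha' : ∑ c, (Pi.single (0 : Fin 3) θ : Fin 3 → ℝ) c ^ 2 = θ ^ 2 := by
    simp [Fin.sum_univ_three]
  have ha : ∑ c, (Pi.single (0 : Fin 3) θ : Fin 3 → ℝ) c ^ 2 ≤ 1 := by
    rw [ha']
    nlinarith [hθ.1, hθ.2]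
  have hb : ∑ c, (Pi.single (1 : Fin 3) (1 : ℝ) : Fin 3 → ℝ) c ^ 2 ≤ 1 := by
    simp [Fin.sum_univ_three]
  rw [plaqObs, plaquetteHolonomy_twoLinkCfg, scalarPart_comm_eq, vecPart_chartSU2 ha, vecPart_chartSU2 hb]
  simp [cross_apply, dotProduct, Fin.sum_univ_three]
  ring

omit [NeZero L] in
/-- **`plaqObs` takes infinitely many values.** [folklore] -/
theorem range_plaqObs_infinite : (Set.range (plaqObs L)).Infinite := by
  have hsub : (fun θ : ℝ => 1 - 2 * θ ^ 2) '' Set.Icc (0 : ℝ) 1 ⊆ Set.range (plaqObs L) := by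
    rintro _ ⟨θ, hθ, rfl⟩
    exact ⟨_, plaqObs_twoLinkCfg_chart hθ⟩
  refine Set.Infinite.mono hsub ((Set.Icc_infinite (zero_lt_one' ℝ)).image fun θ hθ θ' hθ' h => ?_)
  have h2 : θ ^ 2 = θ' ^ 2 := by linarith
  nlinarith [hθ.1, hθ'.1, sq_nonneg (θ - θ'), sq_nonneg (θ + θ')]

/-! ## §6 Full support of the a-priori measure; linear independence of the powers; infinite dimension -/

/-- The a-priori measure charges every non-empty open set (product of Haar measures). [folklore] -/
theorem isOpenPosMeasure_configMeasure : (configMeasure SU2 L).IsOpenPosMeasure := by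
  haveI : (haarProbability SU2).IsOpenPosMeasure := by unfold haarProbability; infer_instance
  show (Measure.pi fun _ : Edge 3 L => haarProbability SU2).IsOpenPosMeasure
  infer_instance

/-- A CONTINUOUS physical test function whose `L²` class vanishes is identically zero. [folklore] -/
theorem coe_eq_zero_of_toL2_eq_zero {ψ : physSubmodule L} (hc : Continuous (ψ : GaugeConfig 3 L SU2 → ℝ)) (h : toL2 ψ = 0) :
    (ψ : GaugeConfig 3 L SU2 → ℝ) = 0 := by
  haveI := isOpenPosMeasure_configMeasure (L := L)
  have h1 : (ψ : GaugeConfig 3 L SU2 → ℝ) =ᵐ[configMeasure SU2 L] (0 : GaugeConfig 3 L SU2 → ℝ) := by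
    have h2 := coeFn_toL2 ψ
    rw [h] at h2
    filter_upwards [h2, Lp.coeFn_zero ℝ 2 (configMeasure SU2 L)] with U hU h0
    rw [← hU, h0]
  exact (hc.ae_eq_iff_eq (μ := configMeasure SU2 L) continuous_const).mp h1

/-- **The classes of the powers `plaqObs^n`, `n ∈ ℕ`, are linearly independent in `L²`.** A vanishing finite combination is a
polynomial in `plaqObs` vanishing a.e., hence everywhere (continuity, full support), hence at the infinitely many values of `plaqObs`:
the polynomial is zero. [folklore] -/
theorem linearIndependent_toL2_plaqObsPow : LinearIndependent ℝ (fun n : ℕ => toL2 (plaqObsPow (L := L) n)) := by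
  classical
  rw [linearIndependent_iff']
  intro s g hsum n hn
  -- the combination as one physical test function, and its vanishing everywhere
  have hlin : toL2 (∑ m ∈ s, g m • plaqObsPow (L := L) m) = 0 := by
    rw [map_sum]
    simpa only [map_smul] using hsum
  have hfun : ((∑ m ∈ s, g m • plaqObsPow (L := L) m : physSubmodule L) : GaugeConfig 3 L SU2 → ℝ) =
      fun U => ∑ m ∈ s, g m * plaqObs L U ^ m := by
    funext U
    rw [Submodule.coe_sum, Finset.sum_apply]
    simp only [Submodule.coe_smul, Pi.smul_apply, smul_eq_mul]
    rfl
  have hcont : Continuous ((∑ m ∈ s, g m • plaqObsPow (L := L) m : physSubmodule L) : GaugeConfig 3 L SU2 → ℝ) := by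
    rw [hfun]
    exact continuous_finsetSum s fun m _ => continuous_const.mul (continuous_plaqObs.pow m)
  have hzero := coe_eq_zero_of_toL2_eq_zero hcont hlin
  -- the polynomial `P = Σ g_m X^m` vanishes on the range of `plaqObs`
  set P : Polynomial ℝ := ∑ m ∈ s, Polynomial.monomial m (g m) with hP
  have heval : ∀ U : GaugeConfig 3 L SU2, P.eval (plaqObs L U) = 0 := by
    intro U
    have h1 := congr_fun hzero U
    rw [hfun] at h1
    rw [hP, Polynomial.eval_finsetSum]
    simp only [Polynomial.eval_monomial, Pi.zero_apply] at h1 ⊢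
    exact h1
  have hroots : Set.Infinite {x : ℝ | P.IsRoot x} :=
    Set.Infinite.mono (by rintro _ ⟨U, rfl⟩; exact heval U) range_plaqObs_infinite
  have hP0 : P = 0 := Polynomial.eq_zero_of_infinite_isRoot P hroots
  have hcoeff : P.coeff n = g n := by
    rw [hP, Polynomial.finsetSum_coeff]
    simp only [Polynomial.coeff_monomial]
    rw [Finset.sum_ite_eq' s n, if_pos hn]
  rw [← hcoeff, hP0, Polynomial.coeff_zero]

/-- **The physical closed subspace of `L²(configMeasure)` is infinite-dimensional.** [folklore] -/
theorem not_finiteDimensional_physL2 : ¬ FiniteDimensional ℝ (physL2 L) := by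
  intro hfin
  set w : ℕ → physL2 L := fun n => ⟨toL2 (plaqObsPow (L := L) n), toL2_mem_physL2 _⟩ with hw
  have hind : LinearIndependent ℝ w := by
    refine LinearIndependent.of_comp (physL2 L).subtype ?_
    exact linearIndependent_toL2_plaqObsPow
  have hind' : LinearIndependent ℝ (w ∘ (Fin.val : Fin (Module.finrank ℝ (physL2 L) + 1) → ℕ)) :=
    hind.comp _ Fin.val_injective
  have h := hind'.fintype_card_le_finrank
  rw [Fintype.card_fin] at h
  omega

end Summit.QuantumFields.YangMills.Theorems.FemtoTransferGap.PhysL2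

end
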